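import Summits.AnomalousDissipation.AnomalousDissipation.Theorems.SawtoothPulseCascadeK1LocalisedCascadeLedgerArith
import Summits.AnomalousDissipation.AnomalousDissipation.Theorems.SawtoothPulseCascadeK1LocalisedCascadeLedgerClassChain

/-!
# K1loc, line `Spectral` / thin start — helper: THE JUNK OF A FAMILY OF GEOMETRIC FIBRE BLOCKS (closed form)

Helper file of the prover lane on the crux `K1LocalisedCascade` (stmt-AnomalousDissipation-19491), route `SawtoothPulseCascade`
(S-B/S-C assembly seat; the LEDGER ASSEMBLY, arithmetic layer).  The multi-block class steps (`…RatioBlocks`, `…StripBlocks`)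
leave the junk ENERGY `Σ_{m<M} J_m²`, `J_m = r_m·(ε₀^m + A_m·√(2N_j·4d₀^m))`, to be bounded.  On geometric blocks `Λ_m = Λ₀·2^m`
with the canonical choices of `K1Window.envelopeScale_facts` (`d₀^m = 8τ_m/A_m + Mδ/(πN)`) and a rounding allowance
`ε₀^m ≤ e₀·2^{m+1}` (`e₀ = A*πGηΛ₀/N`, `η ≥ e^{−M²/2}`), and with block constants `r_m ≤ r*`, `A_m ≤ A*`, `τ_m ≤ τ₀/2^m`, the sum is
at most **`3·r*²·((4/3)·(e₀·2^M)² + 128·N·A*·τ₀ + 8·M_b·A*²·Mδ/π)`** (`blockJunk_sum_le`): the kernel-layer part is GEOMETRIC over the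
blocks (only `Λ₀` counts), the corner-zone part grows linearly with the number of blocks, the rounding part is governed by the
far radius `Λ₀·2^M`.  Window-agnostic (ratio and strip windows alike); pure real arithmetic; no definitions; no statement about the
crux. [cite: Grafakos2014, Prop. 3.2.7 (3)] [problem: turb]
-/

-- `Summit.<Summit>.<Problem>`: single-conjunct summit, the duplicate namespace segment is deliberate.
set_option linter.dupNamespace false

noncomputable section

namespace Summit.AnomalousDissipation.AnomalousDissipation.Theorems.SawtoothPulseCascade.K1Window

open Finset
open Summit.AnomalousDissipation.AnomalousDissipation.Theorems.SawtoothPulseCascade.K1Ledger.From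

/-- `Σ_{m<M} (1/2)^m ≤ 2`. [folklore] -/
theorem sum_range_half_pow_le (M : ℕ) : ∑ m ∈ range M, (1 / 2 : ℝ) ^ m ≤ 2 := by
  have hs : Summable fun m : ℕ => (1 / 2 : ℝ) ^ m := summable_geometric_two
  calc ∑ m ∈ range M, (1 / 2 : ℝ) ^ m ≤ ∑' m : ℕ, (1 / 2 : ℝ) ^ m :=
      hs.sum_le_tsum (range M) (fun m _ => by positivity)
    _ = 2 := tsum_geometric_two

/-- `Σ_{m<M} (2^{m+1})² ≤ (4/3)·(2^M)²`. [folklore] -/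
theorem sum_range_sq_two_pow_succ_le (M : ℕ) :
    ∑ m ∈ range M, ((2 : ℝ) ^ (m + 1)) ^ 2 ≤ 4 / 3 * ((2 : ℝ) ^ M) ^ 2 := by
  have e : ∀ m : ℕ, ((2 : ℝ) ^ (m + 1)) ^ 2 = 4 * (4 : ℝ) ^ m := fun m => by
    rw [← pow_mul, mul_comm (m + 1) 2, pow_mul, pow_succ]; norm_num [mul_comm]
  simp_rw [e, ← Finset.mul_sum]
  have hg : ∑ m ∈ range M, (4 : ℝ) ^ m = ((4 : ℝ) ^ M - 1) / (4 - 1) := geom_sum_eq (by norm_num) M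
  rw [hg]
  have e2 : ((2 : ℝ) ^ M) ^ 2 = (4 : ℝ) ^ M := by rw [← pow_mul, mul_comm M 2, pow_mul]; norm_num
  rw [e2]
  have : (0 : ℝ) ≤ (4 : ℝ) ^ M := by positivity
  nlinarith

/-- **One block's junk amplitude** under the canonical envelope scale: with `d₀ = 8τ/A + Mδ/(πN)` (`A, N > 0`),
`A·√(2N·4d₀) ≤ √(64·N·A·τ) + A·√(8·Mδ/π)`. [folklore] -/
theorem block_envelope_amplitude_le {A N : ℝ} (τ Mδ : ℝ) (hA : 0 < A) (hN : 0 < N) :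
    A * Real.sqrt (2 * N * (4 * (8 * τ / A + Mδ / (Real.pi * N)))) ≤
      Real.sqrt (64 * N * A * τ) + A * Real.sqrt (8 * Mδ / Real.pi) := by
  have hπ := Real.pi_pos
  have key : ∀ X : ℝ, A * Real.sqrt X = Real.sqrt (A ^ 2 * X) := fun X => by
    rw [Real.sqrt_mul (sq_nonneg A), Real.sqrt_sq hA.le]
  have e2 : A ^ 2 * (2 * N * (4 * (8 * τ / A + Mδ / (Real.pi * N)))) = 64 * N * A * τ + A ^ 2 * (8 * Mδ / Real.pi) := by
    field_simp
    ring
  rw [key, key, e2]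
  exact sqrt_add_le_sqrt_add _ _

/-- **THE JUNK OF A FAMILY OF GEOMETRIC BLOCKS** (see the file header): for block constants `0 ≤ r_m ≤ r*`, `0 < A_m ≤ A*`,
`0 ≤ τ_m ≤ τ₀/2^m`, the canonical envelope scale `d₀^m = 8τ_m/A_m + Mδ/(πN)` (`N > 0`, `Mδ ≥ 0`) and rounding allowances
`0 ≤ ε₀^m ≤ e₀·2^{m+1}`:
`Σ_{m<M_b} (r_m(ε₀^m + A_m√(2N·4d₀^m)))² ≤ 3r*²·((4/3)(e₀2^{M_b})² + 128·N·A*·τ₀ + 8·M_b·A*²·Mδ/π)`. [folklore] -/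
theorem blockJunk_sum_le {r A τ ε₀ : ℕ → ℝ} {rs As τ₀ e₀ N Mδ : ℝ} (hN : 0 < N) (hMδ : 0 ≤ Mδ) (hτ₀ : 0 ≤ τ₀)
    (hr0 : ∀ m, 0 ≤ r m) (hr : ∀ m, r m ≤ rs) (hA0 : ∀ m, 0 < A m) (hA : ∀ m, A m ≤ As)
    (hτ0 : ∀ m, 0 ≤ τ m) (hτ : ∀ m, τ m ≤ τ₀ / 2 ^ m) (hε0 : ∀ m, 0 ≤ ε₀ m) (hε : ∀ m, ε₀ m ≤ e₀ * 2 ^ (m + 1))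
    (Mb : ℕ) :
    ∑ m ∈ range Mb, (r m * (ε₀ m + A m * Real.sqrt (2 * N * (4 * (8 * τ m / A m + Mδ / (Real.pi * N)))))) ^ 2 ≤
      3 * rs ^ 2 * (4 / 3 * (e₀ * 2 ^ Mb) ^ 2 + 128 * N * As * τ₀ + 8 * Mb * As ^ 2 * Mδ / Real.pi) := by
  have hπ := Real.pi_pos
  have hAs : 0 ≤ As := (hA0 0).le.trans (hA 0)
  have hrs : 0 ≤ rs := (hr0 0).trans (hr 0)
  -- per block
  have hblock : ∀ m, (r m * (ε₀ m + A m * Real.sqrt (2 * N * (4 * (8 * τ m / A m + Mδ / (Real.pi * N)))))) ^ 2 ≤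
      3 * rs ^ 2 * (ε₀ m ^ 2 + 64 * N * As * τ₀ * (1 / 2) ^ m + 8 * As ^ 2 * Mδ / Real.pi) := by
    intro m
    have h1 := block_envelope_amplitude_le (τ m) Mδ (hA0 m) hN
    -- bound the two square roots by the block-uniform constants
    have h2 : Real.sqrt (64 * N * A m * τ m) ≤ Real.sqrt (64 * N * As * τ₀ * (1 / 2) ^ m) := by
      refine Real.sqrt_le_sqrt ?_
      have : A m * τ m ≤ As * (τ₀ / 2 ^ m) := mul_le_mul (hA m) (hτ m) (hτ0 m) hAs
      have e : As * (τ₀ / 2 ^ m) = As * τ₀ * (1 / 2) ^ m := by rw [one_div_pow]; ring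
      nlinarith [hN.le]
    have h3 : A m * Real.sqrt (8 * Mδ / Real.pi) ≤ As * Real.sqrt (8 * Mδ / Real.pi) :=
      mul_le_mul_of_nonneg_right (hA m) (Real.sqrt_nonneg _)
    set s := A m * Real.sqrt (2 * N * (4 * (8 * τ m / A m + Mδ / (Real.pi * N)))) with hs
    have hs0 : 0 ≤ s := mul_nonneg (hA0 m).le (Real.sqrt_nonneg _)
    set b := Real.sqrt (64 * N * As * τ₀ * (1 / 2) ^ m) with hb
    set c := As * Real.sqrt (8 * Mδ / Real.pi) with hc
    have hsbc : s ≤ b + c := h1.trans (add_le_add h2 h3)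
    have hin : 0 ≤ ε₀ m + s := add_nonneg (hε0 m) hs0
    have hle : r m * (ε₀ m + s) ≤ rs * (ε₀ m + b + c) := by
      calc r m * (ε₀ m + s) ≤ rs * (ε₀ m + s) := mul_le_mul_of_nonneg_right (hr m) hin
        _ ≤ rs * (ε₀ m + b + c) := mul_le_mul_of_nonneg_left (by linarith) hrs
    have hl0 : 0 ≤ r m * (ε₀ m + s) := mul_nonneg (hr0 m) hin
    calc (r m * (ε₀ m + s)) ^ 2 ≤ (rs * (ε₀ m + b + c)) ^ 2 := pow_le_pow_left₀ hl0 hle 2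
      _ = rs ^ 2 * (ε₀ m + b + c) ^ 2 := by ring
      _ ≤ rs ^ 2 * (3 * (ε₀ m ^ 2 + b ^ 2 + c ^ 2)) :=
          mul_le_mul_of_nonneg_left
            (by nlinarith [sq_nonneg (ε₀ m - b), sq_nonneg (b - c), sq_nonneg (ε₀ m - c)]) (sq_nonneg _)
      _ = 3 * rs ^ 2 * (ε₀ m ^ 2 + 64 * N * As * τ₀ * (1 / 2) ^ m + 8 * As ^ 2 * Mδ / Real.pi) := by
          have eb : b ^ 2 = 64 * N * As * τ₀ * (1 / 2) ^ m := Real.sq_sqrt (by positivity)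
          have ec : c ^ 2 = As ^ 2 * (8 * Mδ / Real.pi) := by
            rw [hc, mul_pow, Real.sq_sqrt (by positivity)]
          rw [eb, ec]; ring
  -- sum over the blocks
  have hε2 : ∀ m, ε₀ m ^ 2 ≤ e₀ ^ 2 * ((2 : ℝ) ^ (m + 1)) ^ 2 := fun m => by
    rw [← mul_pow]; exact pow_le_pow_left₀ (hε0 m) (hε m) 2
  calc ∑ m ∈ range Mb, (r m * (ε₀ m + A m * Real.sqrt (2 * N * (4 * (8 * τ m / A m + Mδ / (Real.pi * N)))))) ^ 2
      ≤ ∑ m ∈ range Mb, 3 * rs ^ 2 * (ε₀ m ^ 2 + 64 * N * As * τ₀ * (1 / 2) ^ m + 8 * As ^ 2 * Mδ / Real.pi) :=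
        Finset.sum_le_sum fun m _ => hblock m
    _ = 3 * rs ^ 2 * (∑ m ∈ range Mb, ε₀ m ^ 2 + 64 * N * As * τ₀ * ∑ m ∈ range Mb, (1 / 2 : ℝ) ^ m +
          Mb * (8 * As ^ 2 * Mδ / Real.pi)) := by
        rw [← Finset.mul_sum, Finset.sum_add_distrib, Finset.sum_add_distrib, Finset.mul_sum, Finset.sum_const,
          Finset.card_range, nsmul_eq_mul]
    _ ≤ 3 * rs ^ 2 * (4 / 3 * (e₀ * 2 ^ Mb) ^ 2 + 128 * N * As * τ₀ + 8 * Mb * As ^ 2 * Mδ / Real.pi) := by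
        refine mul_le_mul_of_nonneg_left ?_ (by positivity)
        have hS1 : ∑ m ∈ range Mb, ε₀ m ^ 2 ≤ 4 / 3 * (e₀ * 2 ^ Mb) ^ 2 := by
          calc ∑ m ∈ range Mb, ε₀ m ^ 2 ≤ ∑ m ∈ range Mb, e₀ ^ 2 * ((2 : ℝ) ^ (m + 1)) ^ 2 :=
              Finset.sum_le_sum fun m _ => hε2 m
            _ = e₀ ^ 2 * ∑ m ∈ range Mb, ((2 : ℝ) ^ (m + 1)) ^ 2 := by rw [Finset.mul_sum]
            _ ≤ e₀ ^ 2 * (4 / 3 * ((2 : ℝ) ^ Mb) ^ 2) :=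
              mul_le_mul_of_nonneg_left (sum_range_sq_two_pow_succ_le Mb) (sq_nonneg _)
            _ = 4 / 3 * (e₀ * 2 ^ Mb) ^ 2 := by ring
        have hS2 : 64 * N * As * τ₀ * ∑ m ∈ range Mb, (1 / 2 : ℝ) ^ m ≤ 128 * N * As * τ₀ := by
          have := sum_range_half_pow_le Mb
          have h0 : 0 ≤ 64 * N * As * τ₀ := by positivity
          nlinarith
        have hS3 : (Mb : ℝ) * (8 * As ^ 2 * Mδ / Real.pi) = 8 * Mb * As ^ 2 * Mδ / Real.pi := by ring
        linarith

end Summit.AnomalousDissipation.AnomalousDissipation.Theorems.SawtoothPulseCascade.K1Window
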